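import Summits.BirchSwinnertonDyer.Rank1Residual.X9.LeafDischarge
import Summits.BirchSwinnertonDyer.Rank1Residual.X10.LeafDischargeX10b
import Summits.BirchSwinnertonDyer.Rank1Residual.X11b.RingClassFieldNoTorsionOfIrreducible
import Summits.BirchSwinnertonDyer.Rank1Residual.X11b.SplitPrimeUnramified
import Literature.NumberTheory.EllipticCurves.WeilPairingProofs
import HarnessLib

/-!
# Class X9 / X10b: the DISCHARGE INTERFACE for Gross's Lemma 4.3 / McCallum §4 (5) over RING CLASS
# FIELDS on Heegner frames — `E(K[m])[p^M] = 0` and the admissibility of `E(K[m]) ⊆ E(K̄)` modulo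
# `p^M` (the `hA` binder of the Kolyvagin machinery), from (irr) and `p` split, UNCONDITIONALLY

Print-tier cell `bsd-print-x9` (D-0131 (2), key `x9`), typer seat ty2, file K of the discharge
interface (A = `X9/LeafDischarge`, B = `X10/LeafDischargeX10b`). Theorems only: no definition, no
new named fact (D-0014 / D-0026); nothing here is a class theorem; X9 and X10b keep their labels.

WHY. Every Kolyvagin-system kernel in the tree (bsd-jet's H63 line
`JET.tamagawaExponent_le_mInfty_of_kernelInputs_v3` and core-vertex walk; bsd-stepL's §6 walk
`Koly.tamagawaExponent_le_m_of_…Families`; the sign `JET.sign_conjAct_kolyvaginClass`; pv-1's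
stringent local conditions) reads the image of `ρ̄_{E,p}` for ONE purpose besides the Čebotarev step:
"the curve `E` has no `K_n`-rational `p`-torsion" (Gross 1991 Lemma 4.3; McCallum 1991 §4 (5)),
consumed as the admissibility of `A = E(K[m])` modulo `p^M` (`KolyvaginCocycle.IsAdmissible`). The
surjective supply is x11b3-p3's `RingClassNoTorsion.isAdmissible_pointsSubgroup` (`Surj W p`); the
irreducible supply is x11b3-p4's `NoTorsionIrr.isAdmissible_pointsSubgroup_of_hasIrreducibleModPGaloisRep`
with THREE side conditions — the Weil pairing on `E[p]` (a tree THEOREM, `exists_weilPairing_holds`),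
`p` unramified in `K`, and `p ∤ m`. On an X9 / X10b Heegner frame all three are automatic: `p` is
SPLIT in `K` (`SatisfiesHeegnerHypothesis p K`), hence unramified
(`X11b.isUnramifiedIn_of_satisfiesHeegnerHypothesis_of_dvd`), and a Kolyvagin conductor is prime to
`p` (its prime factors are Kolyvagin primes, `≠ p`). This file reads the supply ON THE LEAF so that
provers porting those kernels to crux J = `HeegnerDivisibilityX9` (item stmt-BirchSwinnertonDyer-20392)
or to the X10b Heegner road at `3` (crux J₃) replace `hρ` by one name (cell dossier v6 §19, rows
«(5)/Lemma 4.3» and «mechanical re-threads»). The bsd-potss twins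
(`JetchevIrreducibleReadingThm52Bricks.isAdmissible_of_irreducible_of_dvd_conductorNorm`, …) carry
`p ∣ N_E` instead (additive base); here `p` is GOOD.

WHAT.
1. Frame lemmas (image input: `E[p]` irreducible only; frame: `K` imaginary quadratic, `p` odd and
   split in `K`): `torsionBy_ringClassField_eq_bot_of_irr_of_split` (`E(K[m])[p] = 0`, `p ∤ m`),
   `torsionBy_pow_ringClassField_eq_bot_of_irr_of_split` (`E(K[m])[p^M] = 0`),
   `isAdmissible_pointsSubgroup_of_irr_of_split` (+ `_of_dvd` family form), and the Kolyvagin-conductor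
   forms `not_dvd_of_forall_isKolyvaginPrime'`, `isAdmissible_of_irr_of_split_kolyvagin` (square-free `c`
   with Zhang–Kolyvagin prime factors, data at the divisors of `c` — the exact `hA`/admissibility call
   shape of the H63 line and of the §6 walk).
2. `ClassX9.torsionBy_ringClassField_pow_eq_bot_of_heegner`, `ClassX9.isAdmissible_pointsSubgroup_of_heegner`,
   `ClassX9.isAdmissible_of_heegner_kolyvagin` — 1 on every X9 Heegner frame with `p` split, by name.
3. `ClassX10.…` — the X10b twins at `p = 3`.

## References

* [GrossLMS1991] B. H. Gross, *Kolyvagin's work on modular elliptic curves*, LMS LN 153 (1991), §4,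
  Lemma 4.3 and (4.2) (held `book:editornd-l-functions-arithmetic`, PDF p. 219).
* [McCallumLMS1991] W. G. McCallum, *Kolyvagin's work on Shafarevich–Tate groups*, LMS LN 153
  (1991), §4 (5) (p. 300).
* [Cox2013] D. A. Cox, *Primes of the form x² + ny²*, 2nd ed., §9.A (ring class fields unramified
  outside the conductor).
* [WZhang2014] W. Zhang, Camb. J. Math. 2 (2014), Notations (xii) (Kolyvagin primes are prime to `p`).
presearch (D-0021): `lean search 'isAdmissible_pointsSubgroup|torsionBy_ringClassField'` → x11b3-p3
(Surj), x11b3-p4 `NoTorsionIrr.…` (irr + 3 side conditions), potss `…_of_dvd_conductorNorm` (`p ∣ N_E`),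
stepL corner inlined calls at `hHp`; no by-name supply on a frame with `p` good and split — this file.
-/

set_option autoImplicit false

noncomputable section

open scoped Classical

open WeierstrassCurve NumberField IsDedekindDomain Field
  Literature.NumberTheory.EllipticCurves Literature.NumberTheory.EllipticCurves.ModularForms
  Literature.NumberTheory.EllipticCurves.KolyvaginCocycle Literature.NumberTheory.GaloisRepresentations
  Summit.BirchSwinnertonDyer.Rank1Residual Summit.BirchSwinnertonDyer.Rank1Residual.X11b

namespace Literature.NumberTheory.EllipticCurves.Rank1Residual

/-! ### 1. Frame lemmas: (irr), `p` odd and split in `K` -/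

section Frame

variable (W : WeierstrassCurve ℚ) [W.IsElliptic] {K : Type} [Field K] [NumberField K] {p : ℕ}

/-- **`E(K[m])[p] = 0`** for `K` imaginary quadratic with `p` split in `K`
(`SatisfiesHeegnerHypothesis p K`), `p` odd, `E[p]` irreducible and `p ∤ m` (`m ≠ 0`): Gross 1991
Lemma 4.3 without surjectivity — x11b3-p4's
`NoTorsionIrr.torsionBy_ringClassField_eq_bot_of_hasIrreducibleModPGaloisRep` with the Weil pairing
PROVED (`exists_weilPairing_holds`) and `p` unramified in `K` from `p` split.
[cite: GrossLMS1991, §4, Lemma 4.3] [cite: Cox2013, §9.A] -/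
theorem torsionBy_ringClassField_eq_bot_of_irr_of_split (hK : IsImaginaryQuadratic K) (ι : K →+* ℂ)
    {m : ℕ} (hm : m ≠ 0) (hp : p.Prime) (hp2 : p ≠ 2) (hirr : W.HasIrreducibleModPGaloisRep p)
    (hHp : SatisfiesHeegnerHypothesis p K) (hpm : ¬ p ∣ m) :
    AddSubgroup.torsionBy (W.baseChange (ringClassField K ι m)).toAffine.Point (p : ℤ) = ⊥ :=
  NoTorsionIrr.torsionBy_ringClassField_eq_bot_of_hasIrreducibleModPGaloisRep W hK ι hm hp hp2 hirr
    (W.exists_weilPairing_holds p) (isUnramifiedIn_of_satisfiesHeegnerHypothesis_of_dvd hK hHp hp dvd_rfl)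
    hpm

/-- **`E(K[m])[p^M] = 0`** on the same frame (McCallum 1991 §4 (5): uniqueness of `p^M`-division
points). [cite: McCallumLMS1991, §4 (5)] [cite: GrossLMS1991, §4, Lemma 4.3] -/
theorem torsionBy_pow_ringClassField_eq_bot_of_irr_of_split (hK : IsImaginaryQuadratic K) (ι : K →+* ℂ)
    {m : ℕ} (hm : m ≠ 0) (hp : p.Prime) (hp2 : p ≠ 2) (hirr : W.HasIrreducibleModPGaloisRep p)
    (hHp : SatisfiesHeegnerHypothesis p K) (hpm : ¬ p ∣ m) (M : ℕ) :
    AddSubgroup.torsionBy (W.baseChange (ringClassField K ι m)).toAffine.Point ((p ^ M : ℕ) : ℤ) = ⊥ :=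
  NoTorsionIrr.torsionBy_pow_ringClassField_eq_bot_of_hasIrreducibleModPGaloisRep W hK ι hm hp hp2 hirr
    (W.exists_weilPairing_holds p) (isUnramifiedIn_of_satisfiesHeegnerHypothesis_of_dvd hK hHp hp dvd_rfl)
    hpm M

variable {W} {N : ℕ} [NeZero N] {Dt : ModularParametrizationData W N} {β : ℤ} {ι : K →+* ℂ} {n : ℕ}

/-- **The `hA` binder — admissibility of `E(K[n]) ⊆ E(K̄)` modulo `p^M` — from (irr) and `p` split**:
for a Kolyvagin–Heegner datum `d` of conductor `n ≠ 0` with `p ∤ n`, `d.pointsSubgroup` is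
`Γ_K`-stable and `p^M`-torsion-free (x11b3-p4's
`NoTorsionIrr.isAdmissible_pointsSubgroup_of_hasIrreducibleModPGaloisRep`, side conditions discharged
as above). [cite: McCallumLMS1991, §4 (5)] [cite: GrossLMS1991, §4, Lemma 4.3 and (4.2)] -/
theorem isAdmissible_pointsSubgroup_of_irr_of_split (d : KolyvaginHeegnerData Dt β ι n)
    (hK : IsImaginaryQuadratic K) (hn : n ≠ 0) (hp : p.Prime) (hp2 : p ≠ 2)
    (hirr : W.HasIrreducibleModPGaloisRep p) (hHp : SatisfiesHeegnerHypothesis p K) (hpn : ¬ p ∣ n)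
    (M : ℕ) :
    IsAdmissible (absoluteGaloisGroup K) d.pointsSubgroup ((p ^ M : ℕ) : ℤ) :=
  NoTorsionIrr.isAdmissible_pointsSubgroup_of_hasIrreducibleModPGaloisRep d hK hn hp hp2 hirr
    (W.exists_weilPairing_holds p) (isUnramifiedIn_of_satisfiesHeegnerHypothesis_of_dvd hK hHp hp dvd_rfl)
    hpn M

/-- **Family form** of the `hA` binder (data at the divisors `m ∣ n` of one top conductor `n ≠ 0`,
`p ∤ n`), from (irr) and `p` split. [cite: McCallumLMS1991, §4 (5)] [cite: GrossLMS1991, §4, Lemma 4.3] -/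
theorem isAdmissible_pointsSubgroup_of_irr_of_split_of_dvd (hK : IsImaginaryQuadratic K) (hn : n ≠ 0)
    (d : ∀ m : ℕ, m ∣ n → KolyvaginHeegnerData Dt β ι m) (hp : p.Prime) (hp2 : p ≠ 2)
    (hirr : W.HasIrreducibleModPGaloisRep p) (hHp : SatisfiesHeegnerHypothesis p K) (hpn : ¬ p ∣ n)
    (M : ℕ) (m : ℕ) (hm : m ∣ n) :
    IsAdmissible (absoluteGaloisGroup K) (d m hm).pointsSubgroup ((p ^ M : ℕ) : ℤ) :=
  isAdmissible_pointsSubgroup_of_irr_of_split (d m hm) hK (ne_zero_of_dvd_ne_zero hn hm) hp hp2 hirr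
    hHp (fun h ↦ hpn (h.trans hm)) M

omit [W.IsElliptic] [NeZero N] in
/-- A square-free product of Zhang–Kolyvagin primes for `p` is prime to `p` (a Kolyvagin prime is
`≠ p`). (Twin of potss `not_dvd_of_primeFactors_isKolyvaginPrime` / stepL
`not_dvd_of_forall_isKolyvaginPrime`, restated to keep this file's imports light.)
[cite: WZhang2014, Notations (xii)] -/
theorem not_dvd_of_forall_isKolyvaginPrime' [W.IsGloballyMinimal] (hp : p.Prime) {c : ℕ}
    (hc : c ≠ 0) (hcK : ∀ ℓ ∈ c.primeFactors, Zhang2014.IsKolyvaginPrime N W K p ℓ) : ¬ p ∣ c :=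
  fun h ↦ (hcK p (Nat.mem_primeFactors.mpr ⟨hp, h, hc⟩)).2.2.2.1 rfl

/-- **Admissibility of `E(K[m]) ⊆ E(K̄)` modulo `p^k` at every divisor `m` of a KOLYVAGIN CONDUCTOR
`c`** (square-free, all prime factors Zhang–Kolyvagin primes for `p` — so `p ∤ c` automatically),
from (irr) and `p` split: the exact admissibility call of the H63 line
(`JET.localization_kolyvaginClass_mem_kummerSelmerStructure_of_GZ31_kolyvagin`,
`JET.exists_datum_addOrderOf_kolyvaginClass_of_m_eq`, `JET.sign_conjAct_kolyvaginClass`) with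
`RingClassNoTorsion.isAdmissible_pointsSubgroup … hρ` replaced.
[cite: McCallumLMS1991, §4 (5)] [cite: GrossLMS1991, §4, Lemma 4.3] [cite: WZhang2014, Notations (xii)] -/
theorem isAdmissible_of_irr_of_split_kolyvagin [W.IsGloballyMinimal] (hK : IsImaginaryQuadratic K)
    (hp : p.Prime) (hp2 : p ≠ 2) (hirr : W.HasIrreducibleModPGaloisRep p)
    (hHp : SatisfiesHeegnerHypothesis p K) {c : ℕ} (hc : Squarefree c)
    (hcK : ∀ ℓ ∈ c.primeFactors, Zhang2014.IsKolyvaginPrime N W K p ℓ)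
    (data : (m : ℕ) → m ∣ c → KolyvaginHeegnerData Dt β ι m) (k : ℕ) (m : ℕ) (hm : m ∣ c) :
    IsAdmissible (absoluteGaloisGroup K) (data m hm).pointsSubgroup ((p ^ k : ℕ) : ℤ) :=
  isAdmissible_pointsSubgroup_of_irr_of_split_of_dvd hK hc.ne_zero data hp hp2 hirr hHp
    (not_dvd_of_forall_isKolyvaginPrime' hp hc.ne_zero hcK) k m hm

end Frame

/-! ### 2. On X9 Heegner frames (`p ∈ {5, 7}`, `E[p]` irreducible, `ρ̄` not onto, `p` split) -/

section Leaf

variable {W : WeierstrassCurve ℚ} [W.IsElliptic] [W.IsGloballyMinimal] {p : ℕ} [Fact p.Prime]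
  {K : Type} [Field K] [NumberField K] {N : ℕ} [NeZero N]
  {Dt : ModularParametrizationData W N} {β : ℤ} {ι : K →+* ℂ}

omit [NeZero N] in
/-- **`E(K[m])[p^M] = 0` on X9 Heegner frames with `p` split** (`m ≠ 0`, `p ∤ m`): Gross Lemma 4.3 /
McCallum §4 (5) BY NAME on the leaf, UNCONDITIONAL. [cite: GrossLMS1991, §4, Lemma 4.3]
[cite: McCallumLMS1991, §4 (5)] -/
theorem ClassX9.torsionBy_ringClassField_pow_eq_bot_of_heegner (h : ClassX9 W p)
    (hK : IsImaginaryQuadratic K) (ι : K →+* ℂ) {m : ℕ} (hm : m ≠ 0)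
    (hHp : SatisfiesHeegnerHypothesis p K) (hpm : ¬ p ∣ m) (M : ℕ) :
    AddSubgroup.torsionBy (W.baseChange (ringClassField K ι m)).toAffine.Point ((p ^ M : ℕ) : ℤ) = ⊥ :=
  torsionBy_pow_ringClassField_eq_bot_of_irr_of_split W hK ι hm Fact.out h.ne_two h.irr hHp hpm M

/-- **The `hA` binder on X9 Heegner frames with `p` split** (datum of conductor `n ≠ 0`, `p ∤ n`):
admissibility of `E(K[n]) ⊆ E(K̄)` modulo `p^M`, BY NAME, UNCONDITIONAL.
[cite: McCallumLMS1991, §4 (5)] [cite: GrossLMS1991, §4, Lemma 4.3 and (4.2)] -/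
theorem ClassX9.isAdmissible_pointsSubgroup_of_heegner (h : ClassX9 W p) {n : ℕ}
    (d : KolyvaginHeegnerData Dt β ι n) (hK : IsImaginaryQuadratic K) (hn : n ≠ 0)
    (hHp : SatisfiesHeegnerHypothesis p K) (hpn : ¬ p ∣ n) (M : ℕ) :
    IsAdmissible (absoluteGaloisGroup K) d.pointsSubgroup ((p ^ M : ℕ) : ℤ) :=
  isAdmissible_pointsSubgroup_of_irr_of_split d hK hn Fact.out h.ne_two h.irr hHp hpn M

/-- **Admissibility at every divisor of a Kolyvagin conductor on X9 Heegner frames with `p` split**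
— the H63 line's / §6 walk's admissibility call with `hρ` replaced by the leaf, UNCONDITIONAL.
[cite: McCallumLMS1991, §4 (5)] [cite: GrossLMS1991, §4, Lemma 4.3] [cite: WZhang2014, Notations (xii)] -/
theorem ClassX9.isAdmissible_of_heegner_kolyvagin (h : ClassX9 W p) (hK : IsImaginaryQuadratic K)
    (hHp : SatisfiesHeegnerHypothesis p K) {c : ℕ} (hc : Squarefree c)
    (hcK : ∀ ℓ ∈ c.primeFactors, Zhang2014.IsKolyvaginPrime N W K p ℓ)
    (data : (m : ℕ) → m ∣ c → KolyvaginHeegnerData Dt β ι m) (k : ℕ) (m : ℕ) (hm : m ∣ c) :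
    IsAdmissible (absoluteGaloisGroup K) (data m hm).pointsSubgroup ((p ^ k : ℕ) : ℤ) :=
  isAdmissible_of_irr_of_split_kolyvagin hK Fact.out h.ne_two h.irr hHp hc hcK data k m hm

/-! ### 3. The X10b twins at `p = 3` (`3` split in `K`) -/

omit [NeZero N] in
/-- **`E(K[m])[3^M] = 0` on X10b Heegner frames with `3` split** (`m ≠ 0`, `3 ∤ m`), UNCONDITIONAL.
[cite: GrossLMS1991, §4, Lemma 4.3] [cite: McCallumLMS1991, §4 (5)] -/
theorem ClassX10.torsionBy_ringClassField_pow_eq_bot_of_heegner (h : ClassX10 W p)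
    (hK : IsImaginaryQuadratic K) (ι : K →+* ℂ) {m : ℕ} (hm : m ≠ 0)
    (hHp : SatisfiesHeegnerHypothesis p K) (hpm : ¬ p ∣ m) (M : ℕ) :
    AddSubgroup.torsionBy (W.baseChange (ringClassField K ι m)).toAffine.Point ((p ^ M : ℕ) : ℤ) = ⊥ :=
  torsionBy_pow_ringClassField_eq_bot_of_irr_of_split W hK ι hm Fact.out h.ne_two h.irr hHp hpm M

/-- **The `hA` binder on X10b Heegner frames with `3` split**, UNCONDITIONAL.
[cite: McCallumLMS1991, §4 (5)] [cite: GrossLMS1991, §4, Lemma 4.3 and (4.2)] -/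
theorem ClassX10.isAdmissible_pointsSubgroup_of_heegner (h : ClassX10 W p) {n : ℕ}
    (d : KolyvaginHeegnerData Dt β ι n) (hK : IsImaginaryQuadratic K) (hn : n ≠ 0)
    (hHp : SatisfiesHeegnerHypothesis p K) (hpn : ¬ p ∣ n) (M : ℕ) :
    IsAdmissible (absoluteGaloisGroup K) d.pointsSubgroup ((p ^ M : ℕ) : ℤ) :=
  isAdmissible_pointsSubgroup_of_irr_of_split d hK hn Fact.out h.ne_two h.irr hHp hpn M

/-- **Admissibility at every divisor of a Kolyvagin conductor on X10b Heegner frames with `3` split**,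
UNCONDITIONAL. [cite: McCallumLMS1991, §4 (5)] [cite: GrossLMS1991, §4, Lemma 4.3] -/
theorem ClassX10.isAdmissible_of_heegner_kolyvagin (h : ClassX10 W p) (hK : IsImaginaryQuadratic K)
    (hHp : SatisfiesHeegnerHypothesis p K) {c : ℕ} (hc : Squarefree c)
    (hcK : ∀ ℓ ∈ c.primeFactors, Zhang2014.IsKolyvaginPrime N W K p ℓ)
    (data : (m : ℕ) → m ∣ c → KolyvaginHeegnerData Dt β ι m) (k : ℕ) (m : ℕ) (hm : m ∣ c) :
    IsAdmissible (absoluteGaloisGroup K) (data m hm).pointsSubgroup ((p ^ k : ℕ) : ℤ) :=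
  isAdmissible_of_irr_of_split_kolyvagin hK Fact.out h.ne_two h.irr hHp hc hcK data k m hm

end Leaf

end Literature.NumberTheory.EllipticCurves.Rank1Residual

end
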